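import Summits.Ventures.CertifiedArithmetic.LowPrec.SRPythagorasExchange
import HarnessLib

/-!
# CXIX — The StochasticA truncation is monotone along aligned points of a nested window

HONEST FRAMING: certified error envelopes and provably optimal rounding/accumulation schemes for
low-precision formats under stated cost models; every table by two implementations; no hardware or
vendor claims.

`StochasticA` with `N` random bits truncates the rounding probability to `N` bits; the mean
TRUNCATION of one step at the pre-rounding value `c` is `y(c) = c − E[round c]`
(`= c − stepQ F (probAwayA N) c id`, the `truncQ` of CXVII), and inside a nested window it equals
`resid (c − ⌊c̄⌋) (w(c)/2^N)` (CXIV `cellA`): a SAWTOOTH of the position, NOT monotone.  This file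
proves the structural fact behind every "higher branches truncate at least as much" step of the
open `3 ≤ N < J` analysis (pub-lowprec-sr/SR-PYTHAGORAS-N3-ACCOUNTING-g22.md §4 (i)):

* `NestedWindow.trunc_le_of_aligned` — for window points `c ≤ c'` that are CONGRUENT modulo the
  mean-shift quantum `E = 2^J·g/2^N` (`c' − c ∈ E·ℤ`), `y(c) ≤ y(c')`.  All cases: same cell (equal),
  `c'` exact (then `c` is aligned too and both vanish), `c'` in a higher — hence at least as wide —
  cell (CVI `coarse`: the floor of `c'` is congruent to the floor of `c` modulo the width of `c`'s
  cell; nesting of residues `resid_le_resid_mul`).  No hypothesis on the cell widths: fine cells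
  included.
* `NestedWindow.trunc_nonneg`, `trunc_eq_zero_of_exact`, `resid_int_mul` — range facts;
* `NestedWindow.trunc_le_of_aligned_states` — the form used on accumulation trees: two states
  `a ≤ a'` with `a' − a ∈ E·ℤ` receiving the same summand;
* `Formats.e3m2_trunc_sawtooth` — kernel instance (E3M2, two bits): monotone along an aligned pair
  across binades, and a misaligned pair where the truncation DROPS.

WHY it matters (analysis note §2–§4): by CX/CXVII the Pythagorean law for `3 ≤ N < J` is the
inequality `−2E[Mₙ·Y] ≤ ΣE[VS_k] + spare`; after an exact-SR "up" move the walker sits higher by a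
multiple of the cell width, and whenever that multiple is `E`-aligned the present lemma says it
truncates at least as much from then on (a nonnegative contribution to `E[M·Y]`); the cost of the
law is confined to the misaligned moves, which pay variance slack (CXIV `aligned_child`).  Together
with the tree Chebyshev inequality (CXVIII) this is the monotone-coupling tool of the programme; it
claims nothing about the open law itself.

References: [ConnollyHighamMary2021] (exact SR), [ElararEtAl2025] (`SR_{p,r}` bias to first
order), IEEE P3109 interim report (StochasticA/B/C).  The cell formula is CXIV/CVI of this series.
-/

namespace Summit.Ventures.CertifiedArithmetic.LowPrec.SR

open Literature.ComputerArithmetic.ConnollyHighamMary2021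
open Finset

variable {K : Type*} [Field K] [LinearOrder K] [IsStrictOrderedRing K] [FloorRing K]

namespace LimitedBits

/-! ### 1. Range facts -/

/-- The residue of an integer multiple vanishes: `(m·ρ) mod ρ = 0`. -/
theorem resid_int_mul {ρ : K} (hρ : 0 < ρ) (m : ℤ) : resid ((m : K) * ρ) ρ = 0 := by
  have h := resid_add_mul (y := 0) hρ m
  rw [zero_add] at h
  rw [h]
  simp [resid]

omit [IsStrictOrderedRing K] [FloorRing K] in
/-- An exact point (`⌈c̄⌉ = ⌊c̄⌋`, hence `c ∈ F`) has zero mean truncation, for every rule. -/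
theorem trunc_eq_zero_of_exact (F : Finset K) (q : K → K) {c : K} (hdc : dn F c ≤ c)
    (hcu : c ≤ up F c) (he : up F c = dn F c) : c - stepQ F q c (fun z => z) = 0 := by
  have hc : c = dn F c := le_antisymm (hcu.trans he.le) hdc
  unfold stepQ
  rw [he, ← hc]
  ring

namespace NestedWindow

variable {F : Finset K} {lo hi g : K} {J : ℕ}

/-- Inside a nested window with `0 ≤ lo` the `StochasticA` truncation is nonnegative. -/
theorem trunc_nonneg (hW : NestedWindow F lo hi g J) (hlo : 0 ≤ lo) (N : ℕ) {c : K} (h1 : lo ≤ c)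
    (h2 : c ≤ hi) : 0 ≤ c - stepQ F (probAwayA N) c (fun z => z) := by
  by_cases he : up F c = dn F c
  · obtain ⟨-, -, -, -, hdc, hcu⟩ := hW.cand h1 h2
    exact (trunc_eq_zero_of_exact F (probAwayA N) hdc hcu he).symm.le
  · obtain ⟨j, -, -, -, h0, -⟩ := hW.cellA hlo N h1 h2 he
    exact h0

/-! ### 2. Monotonicity along `E`-congruent points -/

/-- **Aligned monotonicity of the truncation.**  In a nested window with `0 ≤ lo`, for window points
`c ≤ c'` with `c' − c = k·(2^J·g/2^N)` (`k : ℤ`): `y(c) ≤ y(c')` for `StochasticA` with `N` bits,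
`y(c) = c − stepQ F (probAwayA N) c id` — whatever the widths of the two cells. -/
theorem trunc_le_of_aligned (hW : NestedWindow F lo hi g J) (hlo : 0 ≤ lo) (N : ℕ) {c c' : K}
    (h1 : lo ≤ c) (hcc : c ≤ c') (h2 : c' ≤ hi) {k : ℤ}
    (hk : c' - c = k * (2 ^ J * g / 2 ^ N)) :
    c - stepQ F (probAwayA N) c (fun z => z) ≤ c' - stepQ F (probAwayA N) c' (fun z => z) := by
  have hg := hW.pos
  have h2c : c ≤ hi := hcc.trans h2
  have h1' : lo ≤ c' := h1.trans hcc
  by_cases he : up F c = dn F c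
  · obtain ⟨-, -, -, -, hdc, hcu⟩ := hW.cand h1 h2c
    rw [trunc_eq_zero_of_exact F _ hdc hcu he]
    exact hW.trunc_nonneg hlo N h1' h2
  -- `c` rounds in a genuine cell of width `2^j·g`; its truncation is a residue modulo `2^j·g/2^N`
  obtain ⟨j, hjJ, hwj, hτ, -, -⟩ := hW.cellA hlo N h1 h2c he
  obtain ⟨hdF, huF, hlod, huhi, hdc, hcu⟩ := hW.cand h1 h2c
  have hρp : (0 : K) < 2 ^ j * g / 2 ^ N := by positivity
  have htc : c - stepQ F (probAwayA N) c (fun z => z) = resid (c - dn F c) (2 ^ j * g / 2 ^ N) := by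
    rw [hτ]; ring
  have hE : (2 : K) ^ J * g / 2 ^ N = 2 ^ (J - j) * (2 ^ j * g / 2 ^ N) := by
    rw [show (2 : K) ^ J = 2 ^ (J - j) * 2 ^ j by rw [← pow_add, Nat.sub_add_cancel hjJ]]
    ring
  have hwρ : up F c - dn F c = 2 ^ N * (2 ^ j * g / 2 ^ N) := by
    rw [hwj, mul_div_cancel₀ _ (by positivity : (2 : K) ^ N ≠ 0)]
  rw [hE] at hk
  rcases lt_or_ge c' (up F c) with hlt | hge
  · -- same cell: the two offsets differ by a multiple of the quantum, the truncations are equal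
    have hdlt : dn F c' < up F c := lt_of_le_of_lt (hW.cand h1' h2).2.2.2.2.1 hlt
    obtain ⟨hdd, huu⟩ := hW.cell_eq h1 hcc h2 hdlt
    have he' : up F c' ≠ dn F c' := by rw [hdd, huu]; exact he
    obtain ⟨j', -, hwj', hτ', -, -⟩ := hW.cellA hlo N h1' h2 he'
    have hjj : (2 : K) ^ j' * g = 2 ^ j * g := by rw [← hwj', ← hwj, hdd, huu]
    have hsh : c' - dn F c = (c - dn F c) + ((k * 2 ^ (J - j) : ℤ) : K) * (2 ^ j * g / 2 ^ N) := by
      push_cast; linear_combination hk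
    have heq : c' - stepQ F (probAwayA N) c' (fun z => z) = c - stepQ F (probAwayA N) c (fun z => z) := by
      rw [hτ', hτ, hjj, hdd, hsh, resid_add_mul hρp]; ring
    exact le_of_eq heq.symm
  · by_cases he' : up F c' = dn F c'
    · -- `c'` exact: a grid point above `⌈c̄⌉`, congruent to `⌊c̄⌋` modulo the width, so `c` is
      -- aligned as well and both truncations vanish
      obtain ⟨hdF', -, -, -, hdc', hcu'⟩ := hW.cand h1' h2
      have hc' : c' = dn F c' := le_antisymm (hcu'.trans he'.le) hdc'
      obtain ⟨z, hz⟩ := hW.coarse h1 h2c he (dn F c') hdF' (hge.trans hc'.le) (hdc'.trans h2)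
      rw [hwρ, ← hc'] at hz
      have hm : c - dn F c = ((z * 2 ^ N - k * 2 ^ (J - j) : ℤ) : K) * (2 ^ j * g / 2 ^ N) := by
        push_cast; linear_combination hz - hk
      have h0 : c - stepQ F (probAwayA N) c (fun z => z) = 0 := by
        rw [htc, hm, resid_int_mul hρp]
      exact h0.le.trans (trunc_eq_zero_of_exact F (probAwayA N) hdc' hcu' he').symm.le
    · -- `c'` rounds in a cell at or above `⌈c̄⌉`, at least as wide (`j ≤ j'`)
      obtain ⟨j', hj'J, hwj', hτ', -, -⟩ := hW.cellA hlo N h1' h2 he'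
      obtain ⟨hdF', huF', hlod', huhi', hdc', hcu'⟩ := hW.cand h1' h2
      have htc' : c' - stepQ F (probAwayA N) c' (fun z => z) =
          resid (c' - dn F c') (2 ^ j' * g / 2 ^ N) := by
        rw [hτ']; ring
      have hmono := hW.mono c c' h1 hcc h2 he'
      rw [hwj, hwj'] at hmono
      have hjj' : j ≤ j' := by
        have h2pow : (2 : K) ^ j ≤ 2 ^ j' := le_of_mul_le_mul_right hmono hg
        exact (pow_le_pow_iff_right₀ (by norm_num : (1 : K) < 2)).mp h2pow
      have hρρ : (2 : K) ^ j' * g / 2 ^ N = ((2 ^ (j' - j) : ℕ) : K) * (2 ^ j * g / 2 ^ N) := by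
        push_cast
        rw [show (2 : K) ^ j' = 2 ^ (j' - j) * 2 ^ j by rw [← pow_add, Nat.sub_add_cancel hjj']]
        ring
      have hud : up F c ≤ dn F c' := le_dn_of_mem huF hge
      obtain ⟨z, hz⟩ := hW.coarse h1 h2c he (dn F c') hdF' hud (hdc'.trans h2)
      rw [hwρ] at hz
      have hsh : c' - dn F c' =
          (c - dn F c) + ((k * 2 ^ (J - j) - z * 2 ^ N : ℤ) : K) * (2 ^ j * g / 2 ^ N) := by
        push_cast; linear_combination hk - hz
      calc c - stepQ F (probAwayA N) c (fun z => z)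
          = resid (c - dn F c) (2 ^ j * g / 2 ^ N) := htc
        _ = resid (c' - dn F c') (2 ^ j * g / 2 ^ N) := by rw [hsh, resid_add_mul hρp]
        _ ≤ resid (c' - dn F c') (2 ^ j' * g / 2 ^ N) := by
            rw [hρρ]; exact resid_le_resid_mul hρp (by positivity)
        _ = c' - stepQ F (probAwayA N) c' (fun z => z) := htc'.symm

/-- **The form used on accumulation trees**: two states `a ≤ a'` of a nested window with
`a' − a ∈ (2^J·g/2^N)·ℤ` that receive the same summand `x` (both sums inside the window) satisfy
`y(a + x) ≤ y(a' + x)`. -/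
theorem trunc_le_of_aligned_states (hW : NestedWindow F lo hi g J) (hlo : 0 ≤ lo) (N : ℕ)
    {a a' x : K} (h1 : lo ≤ a + x) (haa : a ≤ a') (h2 : a' + x ≤ hi) {k : ℤ}
    (hk : a' - a = k * (2 ^ J * g / 2 ^ N)) :
    (a + x) - stepQ F (probAwayA N) (a + x) (fun z => z) ≤
      (a' + x) - stepQ F (probAwayA N) (a' + x) (fun z => z) :=
  hW.trunc_le_of_aligned hlo N h1 (by linarith) h2 (k := k) (by rw [← hk]; ring)

end NestedWindow

end LimitedBits

/-! ### 3. Kernel instance -/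

namespace Formats

open LimitedBits

/-- E3M2 (`g = 1/4`, `J = 4`, `G = 4`), `StochasticA` with two bits (`E = 1`): along the ALIGNED pair
`35/8 ≤ 35/8 + 7` (binades `[4,8)` and `[8,16)`) the truncation grows, `1/8 ≤ 3/8`; along the
misaligned pair `35/8 < 35/8 + 1/8` it DROPS from `1/8` to `0` — the sawtooth. -/
theorem e3m2_trunc_sawtooth :
    (35 / 8 : ℚ) - stepQ e3m2 (probAwayA 2) (35 / 8) (fun z => z) = 1 / 8 ∧
      (35 / 8 + 7 : ℚ) - stepQ e3m2 (probAwayA 2) (35 / 8 + 7) (fun z => z) = 3 / 8 ∧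
      (35 / 8 + 1 / 8 : ℚ) - stepQ e3m2 (probAwayA 2) (35 / 8 + 1 / 8) (fun z => z) = 0 := by
  refine ⟨?_, ?_, ?_⟩ <;> decide +kernel

end Formats

end Summit.Ventures.CertifiedArithmetic.LowPrec.SR
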